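import Mathlib

/-!
# T5ProductKernel — the bookkeeping half of the product-kernel identity (N1 §ID-4(c))

Sub-step N1 of Tier 5 (route/T5-ID-p2.md, §ID-4(c)) uses the *product-kernel identity*:
the theta kernel of the doubled space `W_a ⊕ W_b`, restricted to `U(W_a) × U(W_b)` and fed
with the tensor-product Schwartz datum `φ_a ⊗ φ_b`, is the pointwise product of the two
vertex kernels, so that the lift against the product character `χ_a ⊠ χ_b` factorises into
the product of the two vertex lifts.  The representation-theoretic input — the restriction
of the Weil representation of the doubled space to the product of the two unitary groups
is the tensor product of the two Weil representations for matching splitting data — is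
CITED in N1 (HKS96 Lemma 5.2 / Cor. A.3, MEMO §15.1(c)) and is NOT proved here: it is
modelled by the hypothesis `IsTensorCompatible`.

What this file proves is the bookkeeping that sits on top of that input, for an abstract
"kernel" `kernel act L φ g := ∑' x : L, act g φ x` (a lattice sum of the transformed
Schwartz function):

* `kernel_tensor` — under `IsTensorCompatible`, the kernel of a pure tensor `φ₁ ⊗ φ₂` over
  the product lattice `L₁ ×ˢ L₂` is the product of the two kernels, provided both lattice
  sums are absolutely convergent (`tsum_mul_tsum_of_summable_norm`, `Equiv.Set.prod`);
* `lift_prod_mul` — the lift `∫ θ(h) f(h) dh` of a product function against a product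
  function over a product measure is the product of the lifts (Fubini:
  `MeasureTheory.integral_prod_mul`);
* `lift_kernel_tensor` — the two combined: the lift of the product kernel against `f₁ ⊠ f₂`
  equals the product of the two vertex lifts;
* linearity bookkeeping: the kernel is additive and homogeneous in the Schwartz datum when
  the action is linear (`kernel_add`, `kernel_smul`, `kernel_sum`), and so is the lift
  (`lift_add_left`, `lift_smul_left`) — the finite-sum step of §ID-3(c) at the kernel level.

Nothing automorphic is formalised: `G`, `H₁`, `H₂` are arbitrary types (the groups of the
line), the "Schwartz functions" are arbitrary functions `X → ℂ`, the "lattices" arbitrary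
subsets, and summability / integrability are hypotheses.
-/

namespace Summit.Ventures.HodgeRepro2.T5ProductKernel

open scoped BigOperators
open MeasureTheory

noncomputable section

/-! ## §1 Kernels as lattice sums -/

section Kernel

variable {G X : Type*}

/-- The tensor product of two functions, `(φ₁ ⊗ φ₂)(x₁, x₂) = φ₁ x₁ * φ₂ x₂`. -/
def tensorFun {X₁ X₂ : Type*} (φ₁ : X₁ → ℂ) (φ₂ : X₂ → ℂ) : X₁ × X₂ → ℂ :=
  fun x => φ₁ x.1 * φ₂ x.2

/-- Evaluation of the tensor product of two functions. -/
@[simp] theorem tensorFun_apply {X₁ X₂ : Type*} (φ₁ : X₁ → ℂ) (φ₂ : X₂ → ℂ) (x : X₁ × X₂) :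
    tensorFun φ₁ φ₂ x = φ₁ x.1 * φ₂ x.2 := rfl

/-- The kernel attached to an action `act` of `G` on functions on `X`, a subset `L ⊆ X`
(the lattice) and a datum `φ`: `g ↦ ∑' x ∈ L, (act g φ) x`. -/
def kernel (act : G → (X → ℂ) → (X → ℂ)) (L : Set X) (φ : X → ℂ) (g : G) : ℂ :=
  ∑' x : L, act g φ x

/-- Unfolding lemma for `kernel`. -/
theorem kernel_def (act : G → (X → ℂ) → (X → ℂ)) (L : Set X) (φ : X → ℂ) (g : G) :
    kernel act L φ g = ∑' x : L, act g φ x := rfl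

/-- For a finite lattice the kernel is the finite sum. -/
theorem kernel_eq_sum (act : G → (X → ℂ) → (X → ℂ)) (L : Finset X) (φ : X → ℂ) (g : G) :
    kernel act (↑L : Set X) φ g = ∑ x ∈ L, act g φ x := by
  unfold kernel
  exact Finset.tsum_subtype L (fun x => act g φ x)

/-- The kernel of a datum whose transform vanishes on the lattice is zero. -/
theorem kernel_eq_zero_of_forall (act : G → (X → ℂ) → (X → ℂ)) (L : Set X) (φ : X → ℂ)
    (g : G) (h : ∀ x ∈ L, act g φ x = 0) : kernel act L φ g = 0 := by
  unfold kernel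
  rw [tsum_congr fun x : L => h x x.2]
  exact tsum_zero

end Kernel

/-! ## §2 Linearity in the Schwartz datum -/

section Linear

variable {G X : Type*}

/-- The kernel of a linear action is additive in the datum when both lattice sums converge. -/
theorem kernel_add (act : G → (X → ℂ) →ₗ[ℂ] (X → ℂ)) (L : Set X) (φ ψ : X → ℂ) (g : G)
    (hφ : Summable fun x : L => act g φ x) (hψ : Summable fun x : L => act g ψ x) :
    kernel (fun g => act g) L (φ + ψ) g =
      kernel (fun g => act g) L φ g + kernel (fun g => act g) L ψ g := by
  unfold kernel
  simp only [map_add, Pi.add_apply]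
  exact hφ.tsum_add hψ

/-- The kernel of a linear action is homogeneous in the datum. -/
theorem kernel_smul (act : G → (X → ℂ) →ₗ[ℂ] (X → ℂ)) (L : Set X) (c : ℂ) (φ : X → ℂ)
    (g : G) :
    kernel (fun g => act g) L (c • φ) g = c * kernel (fun g => act g) L φ g := by
  unfold kernel
  simp only [map_smul, Pi.smul_apply, smul_eq_mul]
  exact tsum_mul_left

/-- A finite linear combination of data has kernel the linear combination of the kernels:
`∑ k, c k • kernel φ_k = kernel (∑ k, c k • φ_k)` (the finite-sum step of §ID-3(c) at the
kernel level), provided each lattice sum converges. -/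
theorem kernel_sum {ι : Type*} (act : G → (X → ℂ) →ₗ[ℂ] (X → ℂ)) (L : Set X)
    (s : Finset ι) (c : ι → ℂ) (φ : ι → X → ℂ) (g : G)
    (hφ : ∀ k ∈ s, Summable fun x : L => act g (φ k) x) :
    kernel (fun g => act g) L (∑ k ∈ s, c k • φ k) g =
      ∑ k ∈ s, c k * kernel (fun g => act g) L (φ k) g := by
  classical
  induction s using Finset.induction_on with
  | empty =>
    simp only [Finset.sum_empty]
    unfold kernel
    simp only [map_zero, Pi.zero_apply, tsum_zero]
  | insert a s ha ih =>
    rw [Finset.sum_insert ha, Finset.sum_insert ha]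
    have hsum : ∀ k ∈ s, Summable fun x : L => act g (φ k) x :=
      fun k hk => hφ k (Finset.mem_insert_of_mem hk)
    have hrest : Summable fun x : L => act g (∑ k ∈ s, c k • φ k) x := by
      have : (fun x : L => act g (∑ k ∈ s, c k • φ k) x) =
          fun x : L => ∑ k ∈ s, c k * act g (φ k) x := by
        funext x
        simp only [map_sum, map_smul, Finset.sum_apply, Pi.smul_apply, smul_eq_mul]
      rw [this]
      exact summable_sum fun k hk => (hsum k hk).mul_left (c k)
    have hfirst : Summable fun x : L => act g (c a • φ a) x := by
      have : (fun x : L => act g (c a • φ a) x) = fun x : L => c a * act g (φ a) x := by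
        funext x
        simp only [map_smul, Pi.smul_apply, smul_eq_mul]
      rw [this]
      exact (hφ a (Finset.mem_insert_self a s)).mul_left (c a)
    rw [kernel_add act L _ _ g hfirst hrest, kernel_smul, ih hsum]

end Linear

/-! ## §3 The product-kernel identity: lattice sums -/

section Tensor

variable {G G₁ G₂ X₁ X₂ : Type*}

/-- The cited input (HKS96 Lemma 5.2 / Cor. A.3), as a hypothesis: the action of `g` on a
pure tensor is the tensor of the actions of its two projections. -/
def IsTensorCompatible (act : G → (X₁ × X₂ → ℂ) → (X₁ × X₂ → ℂ))
    (act₁ : G₁ → (X₁ → ℂ) → (X₁ → ℂ)) (act₂ : G₂ → (X₂ → ℂ) → (X₂ → ℂ))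
    (p₁ : G → G₁) (p₂ : G → G₂) : Prop :=
  ∀ (g : G) (φ₁ : X₁ → ℂ) (φ₂ : X₂ → ℂ),
    act g (tensorFun φ₁ φ₂) = tensorFun (act₁ (p₁ g) φ₁) (act₂ (p₂ g) φ₂)

/-- The lattice sum over `L₁ ×ˢ L₂` of a pure tensor is the product of the two lattice sums,
for absolutely convergent data. -/
theorem tsum_prod_tensorFun (L₁ : Set X₁) (L₂ : Set X₂) (ψ₁ : X₁ → ℂ) (ψ₂ : X₂ → ℂ)
    (h₁ : Summable fun x : L₁ => ‖ψ₁ x‖) (h₂ : Summable fun x : L₂ => ‖ψ₂ x‖) :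
    ∑' x : (L₁ ×ˢ L₂ : Set (X₁ × X₂)), tensorFun ψ₁ ψ₂ x =
      (∑' x : L₁, ψ₁ x) * ∑' x : L₂, ψ₂ x := by
  rw [tsum_mul_tsum_of_summable_norm h₁ h₂]
  rw [← (Equiv.Set.prod L₁ L₂).symm.tsum_eq]
  rfl

/-- **The product-kernel identity (bookkeeping half).** Under `IsTensorCompatible`, the
kernel of `φ₁ ⊗ φ₂` over `L₁ ×ˢ L₂` at `g` is the product of the kernel of `φ₁` over `L₁`
at `p₁ g` and the kernel of `φ₂` over `L₂` at `p₂ g`, provided both lattice sums converge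
absolutely. -/
theorem kernel_tensor (act : G → (X₁ × X₂ → ℂ) → (X₁ × X₂ → ℂ))
    (act₁ : G₁ → (X₁ → ℂ) → (X₁ → ℂ)) (act₂ : G₂ → (X₂ → ℂ) → (X₂ → ℂ))
    (p₁ : G → G₁) (p₂ : G → G₂) (hact : IsTensorCompatible act act₁ act₂ p₁ p₂)
    (L₁ : Set X₁) (L₂ : Set X₂) (φ₁ : X₁ → ℂ) (φ₂ : X₂ → ℂ) (g : G)
    (h₁ : Summable fun x : L₁ => ‖act₁ (p₁ g) φ₁ x‖)
    (h₂ : Summable fun x : L₂ => ‖act₂ (p₂ g) φ₂ x‖) :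
    kernel act (L₁ ×ˢ L₂) (tensorFun φ₁ φ₂) g =
      kernel act₁ L₁ φ₁ (p₁ g) * kernel act₂ L₂ φ₂ (p₂ g) := by
  unfold kernel
  rw [hact g φ₁ φ₂]
  exact tsum_prod_tensorFun L₁ L₂ _ _ h₁ h₂

end Tensor

/-! ## §4 Lifts against characters and their factorisation -/

section Lift

variable {H : Type*} [MeasurableSpace H]

/-- The lift of a kernel function `θ` against a function `f` (the automorphic form, a
character in the line) for the measure `μ`: `∫ θ(h) f(h) dμ(h)`. -/
def lift (μ : Measure H) (θ f : H → ℂ) : ℂ := ∫ h, θ h * f h ∂μ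

/-- Unfolding lemma for `lift`. -/
theorem lift_def (μ : Measure H) (θ f : H → ℂ) : lift μ θ f = ∫ h, θ h * f h ∂μ := rfl

/-- The lift is additive in the kernel function, for integrable integrands. -/
theorem lift_add_left (μ : Measure H) (θ θ' f : H → ℂ)
    (hθ : Integrable (fun h => θ h * f h) μ) (hθ' : Integrable (fun h => θ' h * f h) μ) :
    lift μ (θ + θ') f = lift μ θ f + lift μ θ' f := by
  unfold lift
  simp only [Pi.add_apply, add_mul]
  exact integral_add hθ hθ'

/-- The lift is homogeneous in the kernel function. -/
theorem lift_smul_left (μ : Measure H) (c : ℂ) (θ f : H → ℂ) :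
    lift μ (c • θ) f = c * lift μ θ f := by
  unfold lift
  simp only [Pi.smul_apply, smul_eq_mul, mul_assoc]
  exact integral_const_mul c _

/-- The lift is homogeneous in the automorphic form. -/
theorem lift_smul_right (μ : Measure H) (c : ℂ) (θ f : H → ℂ) :
    lift μ θ (c • f) = c * lift μ θ f := by
  unfold lift
  simp only [Pi.smul_apply, smul_eq_mul]
  rw [← integral_const_mul]
  congr 1
  funext h
  ring

end Lift

section LiftProd

variable {H₁ H₂ : Type*} [MeasurableSpace H₁] [MeasurableSpace H₂]

/-- **Fubini for lifts.** The lift of a product function `θ₁ ⊠ θ₂` against a product function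
`f₁ ⊠ f₂` over the product measure is the product of the two lifts
(`MeasureTheory.integral_prod_mul`). -/
theorem lift_prod_mul (μ₁ : Measure H₁) (μ₂ : Measure H₂) [SFinite μ₁] [SFinite μ₂]
    (θ₁ f₁ : H₁ → ℂ) (θ₂ f₂ : H₂ → ℂ) :
    lift (μ₁.prod μ₂) (tensorFun θ₁ θ₂) (tensorFun f₁ f₂) =
      lift μ₁ θ₁ f₁ * lift μ₂ θ₂ f₂ := by
  unfold lift
  rw [← integral_prod_mul (fun h₁ => θ₁ h₁ * f₁ h₁) (fun h₂ => θ₂ h₂ * f₂ h₂)]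
  congr 1
  funext h
  simp only [tensorFun_apply]
  ring

/-- **The lift of the product kernel factorises.** For the group of pairs `G × (H₁ × H₂)`
acting on functions on `X₁ × X₂`, compatibly (`IsTensorCompatible` for the two projections
`(g, (h₁, h₂)) ↦ (g, h₁)` and `(g, (h₁, h₂)) ↦ (g, h₂)`), the lift over `H₁ × H₂` of the
product kernel `kernel act (L₁ ×ˢ L₂) (φ₁ ⊗ φ₂) (g, ·)` against `f₁ ⊠ f₂` is the product
of the two vertex lifts, provided every lattice sum converges absolutely. -/
theorem lift_kernel_tensor {G X₁ X₂ : Type*}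
    (act : G × (H₁ × H₂) → (X₁ × X₂ → ℂ) → (X₁ × X₂ → ℂ))
    (act₁ : G × H₁ → (X₁ → ℂ) → (X₁ → ℂ)) (act₂ : G × H₂ → (X₂ → ℂ) → (X₂ → ℂ))
    (hact : IsTensorCompatible act act₁ act₂ (fun gh => (gh.1, gh.2.1))
      (fun gh => (gh.1, gh.2.2)))
    (L₁ : Set X₁) (L₂ : Set X₂) (φ₁ : X₁ → ℂ) (φ₂ : X₂ → ℂ) (g : G)
    (h₁ : ∀ h₁ : H₁, Summable fun x : L₁ => ‖act₁ (g, h₁) φ₁ x‖)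
    (h₂ : ∀ h₂ : H₂, Summable fun x : L₂ => ‖act₂ (g, h₂) φ₂ x‖)
    (μ₁ : Measure H₁) (μ₂ : Measure H₂) [SFinite μ₁] [SFinite μ₂]
    (f₁ : H₁ → ℂ) (f₂ : H₂ → ℂ) :
    lift (μ₁.prod μ₂) (fun h => kernel act (L₁ ×ˢ L₂) (tensorFun φ₁ φ₂) (g, h))
        (tensorFun f₁ f₂) =
      lift μ₁ (fun h₁ => kernel act₁ L₁ φ₁ (g, h₁)) f₁ *
        lift μ₂ (fun h₂ => kernel act₂ L₂ φ₂ (g, h₂)) f₂ := by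
  rw [← lift_prod_mul]
  congr 1
  funext h
  simp only [tensorFun_apply]
  exact kernel_tensor act act₁ act₂ _ _ hact L₁ L₂ φ₁ φ₂ (g, h) (h₁ h.1) (h₂ h.2)

end LiftProd

/-! ## §5 Conventions: the conjugate character versus the inverse character (G-ID-2(a))

N1's gap line G-ID-2(a) records that Liu's lift integrates `θ(g,h) f(g)` while GQT's / route-2's
integrates `θ(g,h) \overline{f(g)}`; for a unitary character the conjugate is the inverse, so the
two conventions differ by `χ ↦ χ⁻¹`. -/

section Conventions

variable {H : Type*} [MeasurableSpace H]

/-- On the unit circle the complex conjugate is the inverse. -/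
theorem conj_eq_inv_of_norm_eq_one {z : ℂ} (hz : ‖z‖ = 1) : starRingEnd ℂ z = z⁻¹ :=
  (Complex.inv_eq_conj hz).symm

/-- For a unimodular automorphic form `f`, the lift against `\overline f` is the lift against
`f⁻¹`: the two printed conventions differ exactly by the inversion of the character. -/
theorem lift_conj_eq_lift_inv (μ : Measure H) (θ f : H → ℂ) (hf : ∀ h, ‖f h‖ = 1) :
    lift μ θ (fun h => starRingEnd ℂ (f h)) = lift μ θ (fun h => (f h)⁻¹) := by
  unfold lift
  congr 1
  funext h
  simp only [conj_eq_inv_of_norm_eq_one (hf h)]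

/-- A unitary character of a group satisfies `\overline{χ(h)} = χ(h⁻¹)`. -/
theorem conj_apply_eq_apply_inv {H : Type*} [Group H] (χ : H →* ℂ) (hχ : ∀ h, ‖χ h‖ = 1)
    (h : H) : starRingEnd ℂ (χ h) = χ h⁻¹ := by
  rw [conj_eq_inv_of_norm_eq_one (hχ h), ← map_inv χ h]

/-- For a unitary character `χ`, the lift against `\overline χ` is the lift against `χ ∘ (·)⁻¹`. -/
theorem lift_conj_char_eq (μ : Measure H) [Group H] (θ : H → ℂ) (χ : H →* ℂ)
    (hχ : ∀ h, ‖χ h‖ = 1) :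
    lift μ θ (fun h => starRingEnd ℂ (χ h)) = lift μ θ (fun h => χ h⁻¹) := by
  unfold lift
  congr 1
  funext h
  simp only [conj_apply_eq_apply_inv χ hχ h]

end Conventions

end

end Summit.Ventures.HodgeRepro2.T5ProductKernel
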